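import Summits.BirchSwinnertonDyer.Rank1Residual.Additive.N10LowerHalfStatements
import Summits.BirchSwinnertonDyer.Rank1Residual.AdditivePotMult.RankOneHeegnerOdd
import HarnessLib
import HarnessLib.Audit.Tags

/-!
# Class O7-ord of the residual map (X3 ∪ X4, analytic rank ONE, additive potentially ORDINARY prime):
# the class statement in Miller's currency, its cells, and its reduction to LOWER halves on X4(M) ∧ surj
# (cell `b2b-bsdres`, lane CLASS-CLOSURE, seat cc-typer-2 = the O7 typer; team n1011, r = 1 strand;
# companion of `Additive/N10LowerHalfStatements.lean` and of n1011-p01's T-O7 `Additive/GordCycLowerBound.lean`)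

HONEST FRAMING (cell `b2b-bsdres`, run/shared/lean/b2b/bsd-rank1-residual/, verbatim in every
file): the goal of the cell is to DELETE the COMBINATION-SHAPED residual classes of the
Birch–Swinnerton-Dyer formula for ALL analytic-rank `≤ 1` elliptic curves over `ℚ` — "full BSD
formula for every rank `≤ 1` curve in class `C`" assembled STRICTLY from published theorems — so
that the rank-`≤ 1` remainder becomes exactly the CONSTRUCTION-SHAPED classes, which are TYPED
(missing-input `Prop`s), NOT attempted. This is not "finishing BSD". Lane CLASS-CLOSURE: research
routes, no claim beyond the stated classes; census output = EVIDENCE / conjecture items, NEVER a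
Literature fact; per-curve certificates (incl. the Schneider certificates below) are instrumentation
only; O7 stays OPEN as a MARK (RESIDUAL-MAP §I O7-ord ∣ O7-ss, SIGNED 2026-08-21T02:29Z); NOTHING is
booked. `@[conjecture]` statements (nothing asserted) and bookkeeping theorems only; no named fact.

## The class (RESIDUAL-MAP §I O7, of record)

"O7-ord — X3 ∪ X4, `r = 1`, additive pot-ORDINARY ((M) ∪ (G-ord) ∪ Gord3): OPEN as MARK (flip rule →
NEEDS `X_D1/X_E1` when the Disegni↔Delbourgo comparison is written); missing inputs NAMED: `X_D1/X_E1`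
(construction) + the ONE unwritten Disegni↔Delbourgo comparison (bookkeeping; not routine at
`p² ∣ N` — ARS 2012 Thm 2.1); per-pair Schneider rider CERTIFIED 11 505/11 505 (rmap-2 g7, §D
addendum 7). IN PRINT: Delbourgo JNT 2002 (A)–(C) [sec, acq-07933], Disegni Compositio 2017 Thm B,
Fouquet 2013 Thm A. Kernel shape: p238418 `bsdp_of_classX4M_of_surj_of_lowerHalves_of_odd`." Counts
of record (S-b, rmap-2 g5/g7): O7-ord 11 505 pairs (X4 4 166 + X3 7 339; (M) 7 816 · Gord3 2 987 ·
(G-ord) `e = 2` 277 · `e ∈ {3,4,6}` 425); windows 230 ‖ 442. O7-ss (19 949 pairs) is NOT this file: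
nothing is formulated there (FORMULATE note in `class-closure/O7/STATEMENT.md`, teams o5/o6).

## What this file types (Miller's currency; the Iwasawa-currency input is n1011-p01's `CycLowerBoundAt`)

* §1 `O7.PPart` — the O7-ord class statement: every pair of the N10 locus (`N10.Locus W p`: odd
  additive `p`, (M) ∨ (G-ord)) with analytic rank ONE satisfies `Typed.MissingPPartAt W p`
  (`ord_p #Ш_an = ord_p #Ш`), with its three cells `O7.PPartM / PPartGordTwo / PPartGordHigher` over
  the N10 cell predicates and the partition `O7.pPart_iff`; and the LOWER-only statements `O7.LowerHalf`,
  `O7.LowerHalfM` (needed in §3). Binder shape = the RANK-ONE conjunct of `x3Sharp_iff_residues`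
  (`∀, r_an = 1 → p ≠ 2 → ClassX3 → SubSemistableTwist → MissingPPartAt`) and `X4SharpRankOne`
  (`∀, r_an = 1 → ClassX4 → Surj → MissingPPartAt`) restricted to potentially ordinary rows (§2).
* §3 **On X4(M) ∧ surj the rank-one statement is LOWER-shaped**: `N10.LowerHalfM ∧ O7.LowerHalfM`
  ⟹ `BSD(E,p)` on X4(M) ∧ surj(p) ∧ `r_an ≤ 1` at every odd `p`, given a modular parametrisation datum
  with `p ∤ c` and `p ∤ ∏ c_ℓ` — through additive-p1's p238418 (Gross–Zagier, Kolyvagin, Kolyvagin's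
  `Ш`-bound, Hoffstein–Luo, newforms: PUBLISHED binders; the rank-zero Heegner twists are X4(M) pairs
  with the same `j`). So the O7-ord residue on (M) ∧ surj is the LOWER half at the pair plus N10(M) at
  its twists — both instances of Delbourgo's Main Conjecture (M) `⊇`-direction (n1011's T = 0 inputs
  of record `CycLowerLeadingTermAt` / `CycLeadingTermDvdAt` in rank 0; p01's `CycLowerBoundAt` in
  rank 1, whose Miller reduction needs Delbourgo 2002 (B) + the certified Schneider rider).

EVIDENCE (instrumentation only; files + sha in the rmap-2 census README gen 7): Schneider non-degeneracy
certified on 11 505/11 505 O7-ord S-b pairs (engines A/B on 11 080 defect-2 pairs, validation 193/0;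
engine C Mazur–Tate integrality on the 425 defect-3/4/6 pairs); Heegner route structurally blocked
(`p ∣ I_K` on every census pair); at `p = 3` on (M): additive-p1 GEN 10's two-engine Heegner-index
certificates (51 X4(M) rank-one window pairs, records p239723) and the image-free BALANCE lever
p238988 close pairs per pair. Pre-registered E1 fit this statement frames: ttrl `requests.jsonl`
l.1205 / l.1247 / l.1282 / l.1298 (experiment X2 = X4-2, cp-bsd-w2). Nothing here is a theorem about
a curve's `Ш` without the conjecture as hypothesis.

References: RESIDUAL-MAP.md §I O7 (cell HOME); CLASS-CLOSURE-PLAN.md §3.3; D. Delbourgo, J. Number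
Theory 95 (2002) 38–71, Main Theorem (A)–(D) [Delbourgo2002]; D. Disegni, Compos. Math. 153 (2017)
Thm. B [Disegni2017]; McCallum, in *L-functions and Arithmetic* (1991) §1 [McCallumLMS1991];
J. Hoffstein, W. Luo, Duke Math. J. (1997) [HoffsteinLuo1997]; R. L. Miller, LMS J. Comput. Math. 14
(2011) Def. 1.1 [Miller2011LMS].
-/

noncomputable section

open scoped Classical

open WeierstrassCurve Literature.NumberTheory.EllipticCurves
  Literature.NumberTheory.EllipticCurves.ModularForms
  Literature.NumberTheory.EllipticCurves.Rank1Residual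
  Literature.NumberTheory.EllipticCurves.Rank1Residual.Typed

namespace Summit.BirchSwinnertonDyer.Rank1Residual.Additive

/-! ## §1 The O7-ord class statements (Miller's currency; `Prop`s, nothing asserted) -/

/-- **Conjecture O7-ord (Miller's currency)**: for every globally minimal `E/ℚ` of analytic rank ONE
and every odd additive prime `p` at which `E` is potentially multiplicative or potentially good
ordinary of type (G) (`N10.Locus W p`), `#Ш(E)_an` is a rational `q` with `ord_p q = ord_p #Ш(E)`
(`Typed.MissingPPartAt W p`). No published or announced theorem proves it on any cell: the Selmer
side (Delbourgo 2002 (A)–(C)) and the analytic `p`-adic Gross–Zagier formula (Disegni 2017 Thm. B) are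
in print at a potentially ordinary `p`, the main-conjecture `⊇`-direction (`X_D1/X_E1`) and the
Disegni↔Delbourgo comparison are not (RESIDUAL-MAP §I O7-ord). OPEN; nothing asserted.
[cite: Delbourgo2002, Main Theorem (A)–(D) (p. 40) (shape only; nothing asserted)] [cite: Miller2011LMS, Def. 1.1] -/
@[conjecture] def O7.PPart : Prop :=
  ∀ (W : WeierstrassCurve ℚ) [W.IsElliptic] [W.IsGloballyMinimal] (p : ℕ) [Fact p.Prime],
    W.analyticRank = 1 → N10.Locus W p → MissingPPartAt W p

/-- **O7-ord(M)**: `O7.PPart` on the cell (M) (`N10.CellM`; S-b 7 816 pairs). OPEN; nothing asserted.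
[cite: Delbourgo2002, Main Theorem (A)–(D) (p. 40) (shape only; nothing asserted)] [cite: Miller2011LMS, Def. 1.1] -/
@[conjecture] def O7.PPartM : Prop :=
  ∀ (W : WeierstrassCurve ℚ) [W.IsElliptic] [W.IsGloballyMinimal] (p : ℕ) [Fact p.Prime],
    W.analyticRank = 1 → N10.CellM W p → MissingPPartAt W p

/-- **O7-ord(G-ord, `e = 2`)**: `O7.PPart` on the cell (G-ord, `e = 2`) (`N10.CellGordTwo`; S-b 277 pairs
at `p ≥ 5` + the Gord3 rows 2 987). OPEN; nothing asserted.
[cite: Delbourgo2002, Main Theorem (A)–(D) (p. 40) (shape only; nothing asserted)] [cite: Miller2011LMS, Def. 1.1] -/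
@[conjecture] def O7.PPartGordTwo : Prop :=
  ∀ (W : WeierstrassCurve ℚ) [W.IsElliptic] [W.IsGloballyMinimal] (p : ℕ) [Fact p.Prime],
    W.analyticRank = 1 → N10.CellGordTwo W p → MissingPPartAt W p

/-- **O7-ord(G-ord, `e ∈ {3,4,6}`)**: `O7.PPart` on the higher-defect cell (`N10.CellGordHigher`; S-b 425
pairs, `p ∈ {5,7,13}`). OPEN; nothing asserted.
[cite: Delbourgo2002, Main Theorem (A)–(D) (p. 40) (shape only; nothing asserted)] [cite: Miller2011LMS, Def. 1.1] -/
@[conjecture] def O7.PPartGordHigher : Prop :=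
  ∀ (W : WeierstrassCurve ℚ) [W.IsElliptic] [W.IsGloballyMinimal] (p : ℕ) [Fact p.Prime],
    W.analyticRank = 1 → N10.CellGordHigher W p → MissingPPartAt W p

/-- **O7-ord is exactly the conjunction of its three cells** (by `N10.locus_iff_cells`). [folklore] -/
theorem O7.pPart_iff : O7.PPart ↔ O7.PPartM ∧ O7.PPartGordTwo ∧ O7.PPartGordHigher := by
  constructor
  · intro h
    exact ⟨fun W _ _ p _ hr hc ↦ h W p hr ((N10.locus_iff_cells W p).mpr (Or.inl hc)),
      fun W _ _ p _ hr hc ↦ h W p hr ((N10.locus_iff_cells W p).mpr (Or.inr (Or.inl hc))),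
      fun W _ _ p _ hr hc ↦ h W p hr ((N10.locus_iff_cells W p).mpr (Or.inr (Or.inr hc)))⟩
  · intro h W _ _ p _ hr hL
    obtain ⟨hM, h2, hH⟩ := h
    rcases (N10.locus_iff_cells W p).mp hL with hc | hc | hc
    · exact hM W p hr hc
    · exact h2 W p hr hc
    · exact hH W p hr hc

/-- **O7-ord, LOWER half only** (`ord_p #Ш_an ≤ ord_p #Ш` at the rank-one pairs of the N10 locus) —
the part of `O7.PPart` that §3 shows to be the WHOLE residue on X4(M) ∧ surj (the upper half there
being reduced to lower halves by Kolyvagin + the Heegner twist). OPEN; nothing asserted.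
[cite: Delbourgo2002, Main Theorem (A)–(D) (p. 40) (shape only; nothing asserted)] [cite: Miller2011LMS, Def. 1.1] -/
@[conjecture] def O7.LowerHalf : Prop :=
  ∀ (W : WeierstrassCurve ℚ) [W.IsElliptic] [W.IsGloballyMinimal] (p : ℕ) [Fact p.Prime],
    W.analyticRank = 1 → N10.Locus W p → MissingLowerBoundAt W p

/-- **O7-ord(M), LOWER half only** (`N10.CellM`, analytic rank one). OPEN; nothing asserted.
[cite: Delbourgo2002, Main Theorem (A)–(D) (p. 40) (shape only; nothing asserted)] [cite: Miller2011LMS, Def. 1.1] -/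
@[conjecture] def O7.LowerHalfM : Prop :=
  ∀ (W : WeierstrassCurve ℚ) [W.IsElliptic] [W.IsGloballyMinimal] (p : ℕ) [Fact p.Prime],
    W.analyticRank = 1 → N10.CellM W p → MissingLowerBoundAt W p

/-- `O7.PPart` gives its lower half. [folklore] -/
theorem O7.lowerHalf_of_pPart (h : O7.PPart) : O7.LowerHalf := fun W _ _ p _ hr hL ↦
  (lower_and_upper_of_missingPPartAt W p (h W p hr hL)).1

/-- `O7.LowerHalf` restricts to the cell (M). [folklore] -/
theorem O7.lowerHalfM_of_lowerHalf (h : O7.LowerHalf) : O7.LowerHalfM := fun W _ _ p _ hr hc ↦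
  h W p hr ((N10.locus_iff_cells W p).mpr (Or.inl hc))

/-! ## §2 Comparison with the kernel's rank-one statements (binder by binder) -/

/-- **The reducible part of O7-ord ⟹ the RANK-ONE conjunct of `x3Sharp_iff_residues`** (X3 end-state
p246661: `∀, r_an = 1 → p ≠ 2 → ClassX3 → SubSemistableTwist → MissingPPartAt`), binder for binder
(the semistable-twist census cell of a class-X3 pair lies in (M) ∪ (G-ord, `e = 2`),
`N10.cellM_or_cellGordTwo_of_classX3_of_subSemistableTwist`). [folklore] -/
theorem O7.x3KernelRankOne_of_pPart (h : O7.PPart) :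
    ∀ (W : WeierstrassCurve ℚ) [W.IsElliptic] [W.IsGloballyMinimal] (p : ℕ) [Fact p.Prime],
      W.analyticRank = 1 → p ≠ 2 → ClassX3 W p → SubSemistableTwist W p → MissingPPartAt W p := by
  intro W _ _ p _ hr hp2 hX hS
  have hc := N10.cellM_or_cellGordTwo_of_classX3_of_subSemistableTwist W p hp2 hX hS
  exact h W p hr ((N10.locus_iff_cells W p).mpr (hc.elim Or.inl (fun h2 ↦ Or.inr (Or.inl h2))))

/-- **`X4SharpRankOne` ⟹ the surjective part of O7-ord** (the tree's rank-one X4♯ conjecture covers all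
additive types; its potentially ordinary rows are O7-ord's irreducible-surjective part, its potentially
supersingular rows are O7-ss). [folklore] -/
theorem O7.pPart_surj_of_x4SharpRankOne (h : X4SharpRankOne) :
    ∀ (W : WeierstrassCurve ℚ) [W.IsElliptic] [W.IsGloballyMinimal] (p : ℕ) [Fact p.Prime],
      W.analyticRank = 1 → N10.Locus W p → Surj W p → MissingPPartAt W p := fun W _ _ p _ hr hL hs ↦
  h W p hr ⟨hL.1, hL.2.1, hasIrreducibleModPGaloisRep_of_hasSurjectiveModNGaloisRep W p hs⟩ hs

/-- **`X3Sharp` ⟹ the reducible part of O7-ord** (fact-free). [folklore] -/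
theorem O7.pPart_red_of_x3Sharp (h : X3Sharp) :
    ∀ (W : WeierstrassCurve ℚ) [W.IsElliptic] [W.IsGloballyMinimal] (p : ℕ) [Fact p.Prime],
      W.analyticRank = 1 → N10.Locus W p → Red W p → MissingPPartAt W p := fun W _ _ p _ hr hL hred ↦
  h W p (by rw [hr]) hL.1 ⟨hred, hL.2.1⟩

/-! ## §3 On X4(M) ∧ surj the rank-one statement is LOWER-shaped (Kolyvagin + Heegner twist, p238418) -/

section PotMultRankOne

variable (W : WeierstrassCurve ℚ) [W.IsElliptic] [W.IsGloballyMinimal] (p : ℕ) [hp : Fact p.Prime]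

/-- **N10(M) ∧ O7-ord(M)-LOWER ⟹ `BSD(E,p)` on X4(M) ∧ surj(p), EITHER analytic rank `≤ 1`, every odd
`p` (so `p = 3`)** — through additive-p1's `bsdp_of_classX4M_of_surj_of_lowerHalves_of_odd` (p238418):
rank `0` from the `ω^{(p−1)/2}`-branch upper half (Delbourgo 1998 Prop. 4 `hDel`, `hmodD`, Wuthrich
Lemma 20 `hL20`, Kato half-eigen `hKato`), rank `1` from Gross–Zagier `hGZ`, Kolyvagin `hKo`,
Kolyvagin's `Ш`-bound `hB`, newforms `hnf`, Hoffstein–Luo `hHL` (the rank-zero Heegner twists are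
X4(M) pairs with the same `j`), GZK `hGZK`, modularity `hmod`; per pair a modular parametrisation
datum `D` at level `N_E` with `p ∤ c(D)` and `p ∤ ∏ c_ℓ` (used in rank one only). The two class
conjectures supply p238418's `hlow` (`∀` X4(M) pairs `V` with `j(V) = j(E)`, `r_an(V) ≤ 1`: the lower
half). So on X4(M) ∧ surj the O7-ord residue is LOWER-shaped: Delbourgo's Main Conjecture (M),
`⊇`-direction, at the pair and at its rank-zero twists. X4(M) stays CONSTRUCTION-SHAPED; nothing booked.
[cite: Delbourgo1998, Prop. 4 (p. 144)] [cite: Wuthrich2014, Lemma 20 (p. 399), Cor. 19 (p. 398)]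
[cite: Kato2004Asterisque, Thm. 17.4 (3) (p. 273)] [cite: McCallumLMS1991, §1 Theorem (Kolyvagin), p. 296]
[cite: HoffsteinLuo1997, Theorem (§1, pp. 435–436)] [cite: Miller2011LMS, §1 and Def. 1.1] -/
theorem O7.bsdp_classX4M_of_surj_of_lowerHalfM_of_n10 (h0 : N10.LowerHalfM) (h1 : O7.LowerHalfM)
    (hDel : Delbourgo1998.prop4_rankZero_pow_dvd_constantCoeff)
    (hmodD : nonempty_modularParametrizationData)
    (hL20 : Wuthrich2014.lemma20_surjective_threeAdic_of_semistable)
    (hKato : Wuthrich2014.kato_halfEigenCharIdeal_dvd_cyclotomicPrime_of_surjective)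
    (hGZ : ∀ (N : ℕ) [NeZero N] (W : WeierstrassCurve ℚ) (K : Type) [Field K] [NumberField K],
      gross_zagier N W K)
    (hKo : ∀ (N : ℕ) [NeZero N] (W : WeierstrassCurve ℚ) (K : Type) [Field K] [NumberField K],
      kolyvagin N W K)
    (hB : ∀ (N : ℕ) [NeZero N] (W : WeierstrassCurve ℚ) (K : Type) [Field K] [NumberField K],
      Kolyvagin1990_padicValNat_card_sha_le N W K)
    (hnf : exists_isNewformOf) (hHL : HoffsteinLuo1997_exists_twist_L_one_ne_zero)
    (hGZK : rank_eq_analyticRank_of_analyticRank_le_one) (hmod : hasEntireLFunction_rat)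
    [NeZero (W.conductorNorm ℤ)]
    (hX : AdditivePotMult.ClassX4M W p) (hr : W.analyticRank ≤ 1) (hsurj : Surj W p)
    (D : ModularParametrizationData W (W.conductorNorm ℤ)) (hc : ¬ (p : ℤ) ∣ D.c)
    (htam : ¬ p ∣ W.tamagawaProduct) : BSDp W p :=
  AdditivePotMult.bsdp_of_classX4M_of_surj_of_lowerHalves_of_odd hDel hmodD hL20 hKato hGZ hKo hB hnf
    hHL hGZK hmod hX hr hsurj D hc htam fun V _ _ hV _ hrV ↦ by
      rcases Nat.le_one_iff_eq_zero_or_eq_one.mp hrV with h | h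
      · exact h0 V p h ((N10.cellM_iff_classX3M_or_classX4M V p).mpr (Or.inr hV))
      · exact h1 V p h ((N10.cellM_iff_classX3M_or_classX4M V p).mpr (Or.inr hV))

end PotMultRankOne

end Summit.BirchSwinnertonDyer.Rank1Residual.Additive

end
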